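import Summits.CriticalPhenomena.PercolationContinuityZ3.Theorems.Transplant.LinkOrthobicupola
import HarnessLib

/-!
# The HEXAGONAL CLOSE PACKING carries NO `PlanarSkeletonConc` — for ANY skeleton map, ANY set of base vertices (class C1b, hcp row:
# the node of record `SamePDropOfSkeletonConcLt` cannot reach hcp; `P2-LATTICES.md` §15/§21/§24)

builds on p205010 (kernel theorem, internal audit signed; external expert review pending) — nothing in this file uses p205010.
Status sentence (coordinator 2026-08-20T04:30Z): "θ(p_c) = 0 on ℤ^d, all d ≥ 2 — kernel-verified (Lean 4/Mathlib, standard axioms); internal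
adversarial audit SIGNED 2026-08-20 04:29Z; external expert review pending."
Lane `prim-bschramm-*`, seat `prim-bschramm-p2` (gen 9; PART C1b class map); helper file (`--supports stmt-CriticalPhenomena-4575 --as helper`).

THE GRAPH (`hcpGraph`, integer model): vertices `ℤ³ ∋ (i, j, z)`; layer `z` is the triangular lattice `{i·a₁ + j·a₂}` (`a₁, a₂` at 60°) for `z`
even (A layers) and its translate by the triangle centroid `δ = (a₁ + a₂)/3` for `z` odd (B layers), stacked ABAB; bonds = the twelve contacts:
six in the layer (`±a₁, ±a₂, ±(a₂ − a₁)`) and three in each adjacent layer (from an A site: offsets `(0,0,±1), (−1,0,±1), (0,−1,±1)`; from a B site: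
`(0,0,±1), (1,0,±1), (0,1,±1)`) — `bonds (evenLayer x)`, `hcp_adj_iff`.  The LINK of every vertex is the triangular orthobicupola `J₂₇`
(`off e : Fin 12 → ℤ³` enumerates the neighbours in the order of `J27.J`; `off_adj_iff`).
THE PROOF (as p5-g5's hexagon argument for `𝕋 □ ℤ`, `Z3DiagonalNoConc`, with the 12-vertex link in place of the hexagon): a `PlanarSkeletonConc Φ`
has a base vertex `t`; the lift `α` of the quarter-turn `R` fixes `t` and permutes its neighbours by an automorphism `π` of the link, so `π⁶ = id`
(`J27.aut_pow_six`) and `α⁶` fixes every neighbour of `t` — in particular the outward step `v` with `φ v − φ t = e₀` ((ι)); but displacements turn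
by `R` under `α` and `R⁶ = −1`, so `e₀ = −e₀`: absurd.  Hence **`isEmpty_planarSkeletonConc_hcp`**: hcp is not a customer of the node of record in
any coordinates (P2 §21 argues by hand, under the assumption Aut = P6₃/mmc, that it carries no `PlanarSkeletonNeg` either; that is not claimed here).
Bare `PlanarSkeleton`s on `hcpGraph` may exist (`φ ≡ const`), so `IsEmpty` of the Conc structure is the right statement.
* §1 `hexVec`, `bonds`, `hcpGraph`, `hcp_adj_iff`, local finiteness, `degree = 12`; §2 `off`, `off_mem`, `exists_off_eq`, `off_adj_iff`;
* §3 **`isEmpty_planarSkeletonConc_hcp`**.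
[cite: ConwaySloane1999, Ch. 4 §6.1 (the hexagonal close packing)] [cite: KozmaNitzan2024, §4 p. 15–16 (Lemma 8: the lattice symmetries)]
[cite: BenjaminiSchramm1996, Conj. 4]
-/

noncomputable section

namespace Summit.CriticalPhenomena.PercolationContinuityZ3.Theorems.Transplant

namespace Hcp

open Literature.Probability.LatticeModels Literature.Probability.Percolation.GM SimpleGraph
open Z3Diag (rot sp_rot_pow_six)

/-! ## §1 The contact graph of the hexagonal close packing -/

/-- Is the layer of `x` an A layer (`z` even)? [folklore] -/
def evenLayer (x : Site 3) : Bool := x 2 % 2 == 0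

/-- The bond vectors from a site of an A layer (`true`) / a B layer (`false`): six in the layer, three up, three down.
[cite: ConwaySloane1999, Ch. 4 §6.1] -/
def bonds (e : Bool) : Finset (Site 3) :=
  if e then {![1, 0, 0], ![0, 1, 0], ![-1, 1, 0], ![-1, 0, 0], ![0, -1, 0], ![1, -1, 0],
      ![0, 0, 1], ![-1, 0, 1], ![0, -1, 1], ![0, 0, -1], ![-1, 0, -1], ![0, -1, -1]}
  else {![1, 0, 0], ![0, 1, 0], ![-1, 1, 0], ![-1, 0, 0], ![0, -1, 0], ![1, -1, 0],
      ![0, 0, 1], ![1, 0, 1], ![0, 1, 1], ![0, 0, -1], ![1, 0, -1], ![0, 1, -1]}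

/-- The parity of the far end of a bond: unchanged in the layer, flipped across layers. [folklore] -/
def tgt (e : Bool) (v : Site 3) : Bool := if v 2 = 0 then e else !e

/-- `0` is not a bond. [folklore] -/
theorem zero_notMem_bonds : ∀ e : Bool, (0 : Site 3) ∉ bonds e := by decide

/-- Bonds change the layer by at most one. [folklore] -/
theorem bonds_apply_two : ∀ e : Bool, ∀ v ∈ bonds e, v 2 = 0 ∨ v 2 = 1 ∨ v 2 = -1 := by decide

/-- **The bond table is symmetric**: the reverse of a bond from an `e`-site is a bond from its far end. [folklore] -/
theorem neg_mem_bonds : ∀ e : Bool, ∀ v ∈ bonds e, -v ∈ bonds (tgt e v) := by decide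

/-- **The hcp contact graph.** [cite: ConwaySloane1999, Ch. 4 §6.1] -/
def hcpGraph : SimpleGraph (Site 3) := SimpleGraph.fromRel fun x y => y - x ∈ bonds (evenLayer x)

/-- The layer parity of the far end of a bond. [folklore] -/
theorem evenLayer_add (x v : Site 3) (hv : v 2 = 0 ∨ v 2 = 1 ∨ v 2 = -1) : evenLayer (x + v) = tgt (evenLayer x) v := by
  unfold evenLayer tgt
  rw [Pi.add_apply]
  rcases hv with h | h | h <;> rw [h]
  · rw [if_pos rfl, add_zero]
  · rw [if_neg (by norm_num)]
    rcases Int.emod_two_eq_zero_or_one (x 2) with hx | hx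
    · rw [hx, show (x 2 + 1) % 2 = 1 by omega]; decide
    · rw [hx, show (x 2 + 1) % 2 = 0 by omega]; decide
  · rw [if_neg (by norm_num)]
    rcases Int.emod_two_eq_zero_or_one (x 2) with hx | hx
    · rw [hx, show (x 2 + -1) % 2 = 1 by omega]; decide
    · rw [hx, show (x 2 + -1) % 2 = 0 by omega]; decide

/-- **Adjacency: `y − x` is a bond from the layer type of `x`.** [folklore] -/
theorem hcp_adj_iff (x y : Site 3) : hcpGraph.Adj x y ↔ y - x ∈ bonds (evenLayer x) := by
  rw [hcpGraph, SimpleGraph.fromRel_adj]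
  constructor
  · rintro ⟨-, h | h⟩
    · exact h
    · have h' := neg_mem_bonds _ _ h
      rw [neg_sub] at h'
      have hy : evenLayer x = tgt (evenLayer y) (x - y) := by
        have := evenLayer_add y (x - y) (bonds_apply_two _ _ h)
        rwa [add_sub_cancel] at this
      rwa [hy]
  · intro h
    refine ⟨fun hxy => zero_notMem_bonds (evenLayer x) ?_, Or.inl h⟩
    subst hxy
    rwa [sub_self] at h

/-- Adjacency of a translate: `x ∼ x + v ↔ v ∈ bonds (evenLayer x)`. [folklore] -/
theorem hcp_adj_add_iff (x v : Site 3) : hcpGraph.Adj x (x + v) ↔ v ∈ bonds (evenLayer x) := by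
  rw [hcp_adj_iff, add_sub_cancel_left]

/-- The neighbours of `x` are the `x + v`, `v` a bond. [folklore] -/
theorem neighborSet_hcp (x : Site 3) : hcpGraph.neighborSet x = ↑((bonds (evenLayer x)).image (x + ·)) := by
  ext y
  rw [SimpleGraph.mem_neighborSet, hcp_adj_iff, Finset.coe_image, Set.mem_image]
  constructor
  · intro h; exact ⟨y - x, h, by abel⟩
  · rintro ⟨s, hs, rfl⟩; simpa using hs

/-- The graph is locally finite. [folklore] -/
instance hcpGraph_locallyFinite : hcpGraph.LocallyFinite := fun x =>
  (((bonds (evenLayer x)).image (x + ·)).finite_toSet.subset (neighborSet_hcp x).le).fintype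

/-- The neighbour finset is the image of the bond table. [folklore] -/
theorem neighborFinset_hcp (x : Site 3) : hcpGraph.neighborFinset x = (bonds (evenLayer x)).image (x + ·) := by
  apply Finset.coe_injective
  rw [SimpleGraph.coe_neighborFinset, neighborSet_hcp]

/-- There are twelve bonds from every site. [cite: ConwaySloane1999, Ch. 4 §6.1 (kissing number 12)] -/
theorem card_bonds : ∀ e : Bool, (bonds e).card = 12 := by decide

/-- **hcp is 12-regular.** [cite: ConwaySloane1999, Ch. 4 §6.1] -/
theorem hcp_degree (x : Site 3) : hcpGraph.degree x = 12 := by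
  rw [← SimpleGraph.card_neighborFinset_eq_degree, neighborFinset_hcp, Finset.card_image_of_injective _ (add_right_injective x), card_bonds]

/-! ## §2 The link of a vertex is the triangular orthobicupola `J₂₇` -/

/-- **The neighbour enumeration in `J₂₇` order**: indices `0–5` the hexagon in cyclic order, `6–8` the upper triangle, `9–11` the lower triangle,
the `i`-th upper/lower neighbour touching the hexagon pair `2i, 2i+1` (for a B site the hexagon is started at `a₂`). [cite: ConwaySloane1999, Ch. 4 §6.1] -/
def off (e : Bool) : Fin 12 → Site 3 :=
  if e then ![![1, 0, 0], ![0, 1, 0], ![-1, 1, 0], ![-1, 0, 0], ![0, -1, 0], ![1, -1, 0],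
      ![0, 0, 1], ![-1, 0, 1], ![0, -1, 1], ![0, 0, -1], ![-1, 0, -1], ![0, -1, -1]]
  else ![![0, 1, 0], ![-1, 1, 0], ![-1, 0, 0], ![0, -1, 0], ![1, -1, 0], ![1, 0, 0],
      ![0, 1, 1], ![0, 0, 1], ![1, 0, 1], ![0, 1, -1], ![0, 0, -1], ![1, 0, -1]]

/-- The enumerated vectors are bonds. [folklore] -/
theorem off_mem : ∀ (e : Bool) (a : Fin 12), off e a ∈ bonds e := by decide

/-- Every bond is enumerated. [folklore] -/
theorem exists_off_eq : ∀ (e : Bool), ∀ v ∈ bonds e, ∃ a : Fin 12, off e a = v := by decide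

/-- The enumeration is injective. [folklore] -/
theorem off_injective : ∀ (e : Bool) (a b : Fin 12), off e a = off e b → a = b := by decide

/-- The enumerated vectors change the layer by at most one. [folklore] -/
theorem off_apply_two (e : Bool) (a : Fin 12) : off e a 2 = 0 ∨ off e a 2 = 1 ∨ off e a 2 = -1 :=
  bonds_apply_two e _ (off_mem e a)

/-- **THE LINK IS `J₂₇`**: two neighbours `x + off e a`, `x + off e b` of an `e`-site `x` are adjacent iff `a ∼ b` in `J27.J`. [cite: ConwaySloane1999, Ch. 4 §6.1] -/
theorem off_adj_table : ∀ (e : Bool) (a b : Fin 12), (off e b - off e a ∈ bonds (tgt e (off e a))) ↔ J27.J.Adj a b := by decide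

/-- The link adjacency at a vertex `x`. [folklore] -/
theorem off_adj_iff (x : Site 3) (a b : Fin 12) :
    hcpGraph.Adj (x + off (evenLayer x) a) (x + off (evenLayer x) b) ↔ J27.J.Adj a b := by
  rw [hcp_adj_iff, show x + off (evenLayer x) b - (x + off (evenLayer x) a) = off (evenLayer x) b - off (evenLayer x) a by abel,
    evenLayer_add x _ (off_apply_two _ a), off_adj_table]

/-! ## §3 No concentric planar skeleton -/

/-- `e₀ ≠ 0` in `ℤ²`. [folklore] -/
theorem single_zero_one_ne_zero : (Pi.single 0 1 : Site 2) ≠ 0 := by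
  intro h; have := congrFun h 0; simp at this

/-- **THEOREM: the hexagonal close packing carries NO `PlanarSkeletonConc`, for any skeleton map and any base vertices.**
[cite: KozmaNitzan2024, §4 p. 15–16 (Lemma 8)] [cite: ConwaySloane1999, Ch. 4 §6.1] [cite: BenjaminiSchramm1996, Conj. 4] -/
theorem isEmpty_planarSkeletonConc_hcp : IsEmpty (PlanarSkeletonConc hcpGraph) := by
  refine ⟨fun Φ => ?_⟩
  obtain ⟨t, ht, -⟩ := Φ.frame (0 : Site 3)
  obtain ⟨α, hαt, hα⟩ := Φ.point t ht rot
  set e := evenLayer t with he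
  -- the neighbour permutation at `t` and the displacement map
  set σ : Site 3 → Site 3 := fun s => α (t + s) - t with hσ
  set d : Site 3 → Site 2 := fun s => Φ.φ (t + s) - Φ.φ t with hd
  have hσt : ∀ s, α (t + s) = t + σ s := fun s => by simp [hσ]
  have hkey : ∀ s, d (σ s) = sp rot (d s) := fun s => by
    show Φ.φ (t + σ s) - Φ.φ t = sp rot (Φ.φ (t + s) - Φ.φ t)
    rw [← hσt]; exact hα (t + s)
  have hkeyn : ∀ n s, d (σ^[n] s) = (sp rot)^[n] (d s) := by
    intro n; induction n with
    | zero => intro s; rfl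
    | succ n ih => intro s; rw [Function.iterate_succ_apply', Function.iterate_succ_apply', hkey, ih]
  have hσmem : ∀ s ∈ bonds e, σ s ∈ bonds e := fun s hs => by
    have h := α.map_adj_iff.2 ((hcp_adj_add_iff t s).2 hs)
    rw [hαt, hσt, hcp_adj_add_iff] at h
    exact h
  have hσinj : Function.Injective σ := fun s s' h => by
    have : α (t + s) = α (t + s') := by rw [hσt, hσt, h]
    exact add_left_cancel (α.injective this)
  -- the induced map on the link indices
  choose π hπ using fun a : Fin 12 => exists_off_eq e (σ (off e a)) (hσmem _ (off_mem e a))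
  have hπinj : Function.Injective π := fun a b h => by
    have : σ (off e a) = σ (off e b) := by rw [← hπ a, ← hπ b, h]
    exact off_injective e a b (hσinj this)
  have hπadj : ∀ a b, J27.J.Adj a b → J27.J.Adj (π a) (π b) := by
    intro a b hab
    rw [← off_adj_iff t] at hab
    have h2 := α.map_adj_iff.2 hab
    rw [hσt, hσt, ← hπ a, ← hπ b] at h2
    exact (off_adj_iff t (π a) (π b)).1 h2
  have hπn : ∀ n a, off e (π^[n] a) = σ^[n] (off e a) := by
    intro n; induction n with
    | zero => intro a; rfl
    | succ n ih => intro a; rw [Function.iterate_succ_apply', Function.iterate_succ_apply', hπ, ih]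
  -- the `step` neighbour with displacement `e₀` is a neighbour, hence `off e a₀` for some `a₀`
  obtain ⟨v, hv, hφv⟩ := Φ.step t 0 1
  set s₀ := v - t with hs₀
  have hs₀mem : s₀ ∈ bonds e := (hcp_adj_iff _ _).1 hv
  have hds₀ : d s₀ = Pi.single 0 1 := by
    show Φ.φ (t + (v - t)) - Φ.φ t = _; rw [add_sub_cancel, hφv]; simp
  obtain ⟨a₀, ha₀⟩ := exists_off_eq e s₀ hs₀mem
  -- `σ⁶ s₀ = s₀` by the link, but the displacement turns by `R⁶ = −1`
  have h6 : σ^[6] s₀ = s₀ := by rw [← ha₀, ← hπn, J27.aut_pow_six hπinj hπadj]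
  have hneg : d s₀ = -(d s₀) := by
    have := hkeyn 6 s₀; rwa [h6, sp_rot_pow_six] at this
  have hzero : d s₀ = 0 := by
    funext i
    have hi := congrFun hneg i
    simp only [Pi.neg_apply, Pi.zero_apply] at hi ⊢
    omega
  exact single_zero_one_ne_zero (hds₀ ▸ hzero)

/-- Pointed form: no `PlanarSkeletonConc` on hcp has any base vertex — the node of record `SamePDropOfSkeletonConcLt` has no hcp instance.
[cite: KozmaNitzan2024, §4 p. 15–16 (Lemma 8)] -/
theorem not_nonempty_planarSkeletonConc_hcp : ¬ Nonempty (PlanarSkeletonConc hcpGraph) :=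
  not_nonempty_iff.2 isEmpty_planarSkeletonConc_hcp

end Hcp

end Summit.CriticalPhenomena.PercolationContinuityZ3.Theorems.Transplant

end
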